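import Summits.MatrixMultiplication.OmegaCensus.STPPVosperSlackTwoSoundCT
import Summits.MatrixMultiplication.OmegaCensus.STPPVosperSlackTwoLawABT
import Summits.MatrixMultiplication.OmegaCensus.STPPVosperSlackTwoSoundCReduce

/-!
# ω-census (abelian STPP census): the slack-2 PARTITION LAW for leaves with several other blocks (table form, any number of blocks)

HONEST FRAMING (pub-omega census; verbatim): lottery ticket; floor = certified bounds/negative ranges.
Census STRUCTURE (seat pub-omega-stpp-1 gen 33, 2026-08-28), family (b2).  `no_isSTPP_of_slack_two_tables`: an STPP family of `ℤ/p` with `N ≥ 2`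
non-empty blocks, block `i` read `(a, b, c)`, the other blocks `ks` with `z = Σ a_k c_k`, `L = Σ b_k c_k`, at SLACK 2 (`z + b + vol + a + L = p`), with
`b, z ≥ 3`, `b + z ≥ 7` (Hamidoune–Rødseth on `(Bᵢ, Z°)`) and either `a = 2` or `a, L ≥ 3`, `a + L ≥ 7` (on `(Aᵢ, Y°)`), is contradicted by four kernel row
families: case A / B′ rows `dihedralSmaller p Q ∨ caseADeadT … Q tbl = true` over the free shapes (`STPPVosperSlackTwoLawABT.lean`), case C rows
`caseCDeadT p c L z Q P h₀ tblC = true` OR the pruned `caseCDeadTP … = true` over `Q ∈ qShapesC b`, `P ∈ pShapesC p a`, `h₀ ∈ [1, z]`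
(`STPPVosperSlackTwoCheckersT(P).lean`, soundness `STPPVosperSlackTwoSoundCT.lean`), and the dead tables `∀ e ∈ tbl?, CoverDead p N i szs? e.1 e.2`
(`STPPVosperSlackTwoCoverDead.lean`).  Case C reduction: the H–R shapes (`slack_two_caseC_HR_A/_B`, `exists_eq_image_erase_of_subset_apFinset`; for
`a = 2` the pair `Aᵢ` itself), the dilation by the inverse of the `(Bᵢ, Z°)`-difference and the translations block-`i` (`Aᵢ ↦ d′·([0,a] ∖ {h′})`), global
`B` (`Bᵢ ↦ [0,b] ∖ {h}`), global `C` (`Z° ↦ [0,z] ∖ {h₀}` — the pinned-`Z°` gauge), with the case-C data of the normalised family re-obtained from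
`slack_two_caseC_of_rowsT`.  The general-`N` analogue of stpp-2 g27's `no_isSTPP_of_slack_two_rowsQ` (`STPPVosperSlackTwoSoundCReduce.lean`).
UNCONDITIONAL given `hHR` (a tree theorem, `hamidouneRodsethInverseTheorem_holds`); no `decide`.  Nothing here is progress on `ω`.

References: H. Cohn, R. Kleinberg, B. Szegedy, C. Umans, FOCS 2005 (arXiv:math/0511460), Def. 5.1; A. G. Vosper, J. London Math. Soc. 31 (1956);
Y. O. Hamidoune, Ø. J. Rødseth, Acta Arith. 92 (2000).
-/

open Finset
open scoped Pointwise

namespace Summit.MatrixMultiplication.OmegaCensus.CubeNB.S2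

open Literature.Computability.AlgebraicComplexity
open Literature.Combinatorics.Additive
open Summit.MatrixMultiplication.OmegaCensus.STPPKneser
open Summit.MatrixMultiplication.OmegaCensus.CubeNB.Bits

variable {p : ℕ} [hp : Fact p.Prime]

/-- **A set as an `(a+1)`-progression minus one term**, for the `(Aᵢ, Y°)` side of case C: either `#X = 2` (then `X = {α, α + d}` is the 3-term
progression `α, α + d, α + 2d` minus its last term), or `3 ≤ a`, `a + L ≥ 7`, `L ≥ 3` and Hamidoune–Rødseth applies to `(−X) + Y`.
[cite: HamidouneRodseth2000, main theorem (§1, p. 252)] -/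
theorem exists_eq_image_erase_caseC_A (hHR : HamidouneRodsethInverseTheorem) {N : ℕ} {A B C : Fin N → Finset (ZMod p)} (hS : IsSTPP A B C)
    (hA : ∀ k, (A k).Nonempty) (hB : ∀ k, (B k).Nonempty) (hC : ∀ k, (C k).Nonempty) (i : Fin N) {a b vol z L : ℕ}
    (ha : #(A i) = a) (hb : #(B i) = b) (hvol : #(A i) * #(B i) * #(C i) = vol)
    (hz : ∑ k ∈ univ.erase i, #(A k) * #(C k) = z) (hL : ∑ k ∈ univ.erase i, #(B k) * #(C k) = L) (hslack : z + b + vol + a + L = p)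
    (ha2 : a = 2 ∨ (3 ≤ a ∧ 3 ≤ L ∧ 7 ≤ a + L))
    (hSY : #((A i).image (fun x => (0 : ZMod p) - x) + DU B C (univ.erase i)) = a + L) :
    ∃ (d αs : ZMod p) (h' : ℕ), d ≠ 0 ∧ 1 ≤ h' ∧ h' ≤ a ∧ (a = 2 → h' = a) ∧
      A i = ((range (a + 1)).erase h').image fun k : ℕ => αs + (k : ZMod p) * d := by
  rcases ha2 with rfl | ⟨h3a, h3L, h7⟩
  · obtain ⟨α₁, α₂, hne, hAi⟩ := card_eq_two.1 ha
    refine ⟨α₂ - α₁, α₁, 2, sub_ne_zero.2 (Ne.symm hne), by norm_num, le_rfl, fun _ => rfl, ?_⟩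
    rw [hAi]
    ext x
    simp only [mem_insert, mem_singleton, mem_image, mem_erase, mem_range]
    constructor
    · rintro (rfl | rfl)
      · exact ⟨0, ⟨by norm_num, by norm_num⟩, by push_cast; ring⟩
      · exact ⟨1, ⟨by norm_num, by norm_num⟩, by push_cast; ring⟩
    · rintro ⟨k, ⟨hk2, hk3⟩, rfl⟩
      interval_cases k
      · left; push_cast; ring
      · right; push_cast; ring
      · exact absurd rfl hk2
  · obtain ⟨d, sA, -, hd, hAsub, -⟩ := slack_two_caseC_HR_A hHR hS hA hB hC i ha hb hvol hz hL hslack h3a h3L h7 hSY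
    obtain ⟨αs, h', h'1, h'a, hAeq⟩ := exists_eq_image_erase_of_subset_apFinset hd (by omega) (by omega) hAsub ha
    exact ⟨d, αs, h', hd, h'1, h'a, fun h2 => by omega, hAeq⟩

/-- **THE SLACK-2 PARTITION LAW, table form, any number of blocks.**  See the module docstring. [cite: CohnKleinbergSzegedyUmans2005, Def. 5.1]
[cite: Vosper1956, main theorem; Nathanson1996, Thm 2.7] [cite: HamidouneRodseth2000, main theorem (§1, p. 252)] -/
theorem no_isSTPP_of_slack_two_tables (hHR : HamidouneRodsethInverseTheorem) {N : ℕ} {A B C : Fin N → Finset (ZMod p)} (hS : IsSTPP A B C)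
    (hA : ∀ k, (A k).Nonempty) (hB : ∀ k, (B k).Nonempty) (hC : ∀ k, (C k).Nonempty) (i : Fin N)
    (hI : ((univ : Finset (Fin N)).erase i).Nonempty) {a b c L z vol : ℕ} (ha : #(A i) = a) (hb : #(B i) = b) (hc : #(C i) = c)
    (hz : ∑ k ∈ univ.erase i, #(A k) * #(C k) = z) (hL : ∑ k ∈ univ.erase i, #(B k) * #(C k) = L)
    (hvol : a * b * c = vol) (hslack : z + b + vol + a + L = p)
    (ha2 : a = 2 ∨ (3 ≤ a ∧ 3 ≤ L ∧ 7 ≤ a + L)) (h2L : 2 ≤ L) (h3b : 3 ≤ b) (h3z : 3 ≤ z) (h7b : 7 ≤ b + z)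
    (ks : List (Fin N)) (hks : ks.Nodup) (hksi : ∀ k, k ∈ ks ↔ k ≠ i) {szsA szsB : List (ℕ × ℕ × ℕ)}
    (hszsA : ks.map (fun k => (#(A k), #(B k), #(C k))) = szsA) (hszsB : ks.map (fun k => (#(B k), #(A k), #(C k))) = szsB)
    {tblA tblB tblC : List (List ℕ × List ℕ)} (deadA : ∀ e ∈ tblA, CoverDead p N i szsA e.1 e.2)
    (deadB : ∀ e ∈ tblB, CoverDead p N i szsB e.1 e.2) (deadC : ∀ e ∈ tblC, CoverDead p N i szsA e.1 e.2)
    (rowsA : ∀ Q ∈ qShapes p b 0 ((p - 1).choose (b - 1)), dihedralSmaller p Q = true ∨ caseADeadT p a c L z Q tblA = true)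
    (rowsB : ∀ Q ∈ qShapes p a 0 ((p - 1).choose (a - 1)), dihedralSmaller p Q = true ∨ caseADeadT p b c z L Q tblB = true)
    (rowsC : ∀ Q ∈ qShapesC b, ∀ P ∈ pShapesC p a, ∀ h₀ ∈ List.range' 1 z,
      caseCDeadT p c L z Q P h₀ tblC = true ∨ caseCDeadTP p c L z Q P h₀ tblC = true) : False := by
  have hp0 : 0 < p := hp.out.pos
  have h2a : 2 ≤ a := by rcases ha2 with h | h <;> omega
  have hvol' : #(A i) * #(B i) * #(C i) = vol := by rw [ha, hb, hc, hvol]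
  -- case C for the given family
  obtain ⟨hSY, hT, -⟩ := slack_two_caseC_of_rowsT hS hA hB hC i hI ha hb hc hz hL hvol hslack h2a (by omega) (by omega) h2L
    ks hks hksi hszsA hszsB deadA deadB rowsA rowsB
  -- the shapes: `Aᵢ` an `(a+1)`-progression minus a term; `Bᵢ`, `Z°` by Hamidoune–Rødseth
  obtain ⟨d, αs, h', hd, h'1, h'a, hh'2, hAeq⟩ := exists_eq_image_erase_caseC_A hHR hS hA hB hC i ha hb hvol' hz hL hslack ha2 hSY
  obtain ⟨e, sB, tZ, he, hBsub, hZsub⟩ := slack_two_caseC_HR_B hHR hS hA hB hC i ha hb hvol' hz hL hslack h3b h3z h7b hT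
  have hZcard : #(DU A C (univ.erase i)) = z := by rw [card_DU_AC hS hB, hz]
  obtain ⟨βs, h, hh1, hhb, hBeq⟩ := exists_eq_image_erase_of_subset_apFinset he (by omega) (by omega) hBsub hb
  obtain ⟨ζs, h₀, hh₀1, hh₀, hZeq⟩ := exists_eq_image_erase_of_subset_apFinset he (by omega) (by omega) hZsub hZcard
  -- the normalisation: dilate by `u = e⁻¹`, translate block `i`, shift `B` and `C` globally
  set u : ZMod p := e⁻¹ with hu
  have hu0 : u ≠ 0 := inv_ne_zero he
  have hue : u * e = 1 := inv_mul_cancel₀ he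
  set t : Fin N → ZMod p := fun k => if k = i then -(u * αs) else 0 with ht
  have hti : t i = -(u * αs) := by simp [ht]
  set β : ZMod p := -(u * βs) - t i with hβ
  set γ : ZMod p := -(u * ζs) with hγ
  have hS2 : IsSTPP (fun k => (A k).image (u * ·)) (fun k => (B k).image (u * ·)) (fun k => (C k).image (u * ·)) := isSTPP_dilate hS hu0
  have hS3 := IsSTPP.translate_shiftBC hS2 t β γ
  set A3 : Fin N → Finset (ZMod p) := fun k => ((A k).image (u * ·)).image (· + t k) with hA3
  set B3 : Fin N → Finset (ZMod p) := fun k => (((B k).image (u * ·)).image (· + t k)).image (· + β) with hB3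
  set C3 : Fin N → Finset (ZMod p) := fun k => (((C k).image (u * ·)).image (· + t k)).image (· + γ) with hC3
  have hS3' : IsSTPP A3 B3 C3 := hS3
  have hmemA3 : ∀ k x, x ∈ A3 k ↔ ∃ v ∈ A k, u * v + t k = x := by
    intro k x; simp only [hA3, mem_image, exists_exists_and_eq_and]
  have hmemB3 : ∀ k x, x ∈ B3 k ↔ ∃ v ∈ B k, u * v + (t k + β) = x := by
    intro k x; simp only [hB3, mem_image, exists_exists_and_eq_and, add_assoc]
  have hmemC3 : ∀ k x, x ∈ C3 k ↔ ∃ v ∈ C k, u * v + (t k + γ) = x := by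
    intro k x; simp only [hC3, mem_image, exists_exists_and_eq_and, add_assoc]
  have hinjA : ∀ k, Function.Injective fun v : ZMod p => u * v + t k := fun k v v' hh => by
    have := mul_left_cancel₀ hu0 (add_right_cancel hh); exact this
  have hinjB : ∀ k, Function.Injective fun v : ZMod p => u * v + (t k + β) := fun k v v' hh => by
    have := mul_left_cancel₀ hu0 (add_right_cancel hh); exact this
  have hinjC : ∀ k, Function.Injective fun v : ZMod p => u * v + (t k + γ) := fun k v v' hh => by
    have := mul_left_cancel₀ hu0 (add_right_cancel hh); exact this
  have hA3eq : ∀ k, A3 k = (A k).image fun v => u * v + t k := fun k => by ext x; rw [hmemA3, mem_image]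
  have hB3eq : ∀ k, B3 k = (B k).image fun v => u * v + (t k + β) := fun k => by ext x; rw [hmemB3, mem_image]
  have hC3eq : ∀ k, C3 k = (C k).image fun v => u * v + (t k + γ) := fun k => by ext x; rw [hmemC3, mem_image]
  have hA3ne : ∀ k, (A3 k).Nonempty := fun k => by rw [hA3eq]; exact (hA _).image _
  have hB3ne : ∀ k, (B3 k).Nonempty := fun k => by rw [hB3eq]; exact (hB _).image _
  have hC3ne : ∀ k, (C3 k).Nonempty := fun k => by rw [hC3eq]; exact (hC _).image _
  have hcardA : ∀ k, #(A3 k) = #(A k) := fun k => by rw [hA3eq, card_image_of_injective _ (hinjA k)]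
  have hcardB : ∀ k, #(B3 k) = #(B k) := fun k => by rw [hB3eq, card_image_of_injective _ (hinjB k)]
  have hcardC : ∀ k, #(C3 k) = #(C k) := fun k => by rw [hC3eq, card_image_of_injective _ (hinjC k)]
  have ha3 : #(A3 i) = a := by rw [hcardA, ha]
  have hb3 : #(B3 i) = b := by rw [hcardB, hb]
  have hc3 : #(C3 i) = c := by rw [hcardC, hc]
  have hz3 : ∑ k ∈ univ.erase i, #(A3 k) * #(C3 k) = z := by
    rw [← hz]; exact Finset.sum_congr rfl fun k _ => by rw [hcardA, hcardC]
  have hL3 : ∑ k ∈ univ.erase i, #(B3 k) * #(C3 k) = L := by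
    rw [← hL]; exact Finset.sum_congr rfl fun k _ => by rw [hcardB, hcardC]
  have hszsA3 : ks.map (fun k => (#(A3 k), #(B3 k), #(C3 k))) = szsA := by
    rw [← hszsA]; exact List.map_congr_left fun k _ => by rw [hcardA, hcardB, hcardC]
  have hszsB3 : ks.map (fun k => (#(B3 k), #(A3 k), #(C3 k))) = szsB := by
    rw [← hszsB]; exact List.map_congr_left fun k _ => by rw [hcardA, hcardB, hcardC]
  -- case C for the normalised family (the rows and tables are universal)
  obtain ⟨-, hT3, hpart3⟩ := slack_two_caseC_of_rowsT hS3' hA3ne hB3ne hC3ne i hI ha3 hb3 hc3 hz3 hL3 hvol hslack h2a (by omega)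
    (by omega) h2L ks hks hksi hszsA3 hszsB3 deadA deadB rowsA rowsB
  -- the normal-form data
  set d' : ℕ := (u * d).val with hd'
  have hd'0 : u * d ≠ 0 := mul_ne_zero hu0 hd
  have hd'1 : 1 ≤ d' := by
    rw [hd']; by_contra hlt
    exact hd'0 ((ZMod.val_eq_zero _).1 (by omega))
  have hd'p : d' < p := (u * d).val_lt
  have hA3i : A3 i = ((range (a + 1)).erase h').image fun k : ℕ => (u * d) * (k : ZMod p) := by
    ext x
    rw [hmemA3, hAeq, hti, mem_image]
    constructor
    · rintro ⟨v, hv, rfl⟩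
      obtain ⟨k, hk, rfl⟩ := mem_image.1 hv
      exact ⟨k, hk, by ring⟩
    · rintro ⟨k, hk, rfl⟩
      exact ⟨αs + (k : ZMod p) * d, mem_image.2 ⟨k, hk, rfl⟩, by ring⟩
  have hB3i : B3 i = ((range (b + 1)).erase h).image fun k : ℕ => (k : ZMod p) := by
    ext x
    rw [hmemB3, hBeq, mem_image]
    constructor
    · rintro ⟨v, hv, rfl⟩
      obtain ⟨k, hk, rfl⟩ := mem_image.1 hv
      refine ⟨k, hk, ?_⟩
      rw [hβ]; linear_combination (-(k : ZMod p)) * hue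
    · rintro ⟨k, hk, rfl⟩
      refine ⟨βs + (k : ZMod p) * e, mem_image.2 ⟨k, hk, rfl⟩, ?_⟩
      rw [hβ]; linear_combination (k : ZMod p) * hue
  have hZ3 : DU A3 C3 (univ.erase i) = ((range (z + 1)).erase h₀).image fun tt : ℕ => (tt : ZMod p) := by
    rw [DU_eq_image_affine u γ (fun k => t k) (fun k => t k + γ) (fun k => by ring) hmemA3 hmemC3, hZeq, image_image]
    refine image_congr fun m _ => ?_
    show u * (ζs + (m : ZMod p) * e) + γ = (m : ZMod p)
    rw [hγ]; linear_combination (m : ZMod p) * hue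
  -- the value lists: the enumerated shapes
  set QL : List ℕ := (List.range (b + 1)).filter fun x => !(Nat.beq x h) with hQL
  set PL : List ℕ := ((List.range (a + 1)).filter fun x => !(Nat.beq x h')).map fun k => (d' * k) % p with hPL
  have hQLq : QL ∈ qShapesC b := by
    rw [qShapesC, List.mem_map]
    exact ⟨h, List.mem_range'.2 ⟨h - 1, by omega, by omega⟩, rfl⟩
  have hPLp : PL ∈ pShapesC p a := by
    rcases ha2 with rfl | ⟨h3a, -, -⟩
    · have hh' : h' = 2 := hh'2 rfl
      rw [pShapesC, if_pos le_rfl, List.mem_map]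
      refine ⟨d', List.mem_range'.2 ⟨d' - 1, by omega, by omega⟩, ?_⟩
      have hfl : (List.range (2 + 1)).filter (fun x => !(Nat.beq x 2)) = [0, 1] := by decide
      rw [hPL, hh', hfl]
      simp [Nat.mod_eq_of_lt hd'p]
    · rw [pShapesC, if_neg (by omega), List.mem_flatMap]
      exact ⟨d', List.mem_range'.2 ⟨d' - 1, by omega, by omega⟩,
        List.mem_map.2 ⟨h', List.mem_range'.2 ⟨h' - 1, by omega, by omega⟩, rfl⟩⟩
  have hfilt : ∀ (n hh k : ℕ), k ∈ (List.range (n + 1)).filter (fun x => !(Nat.beq x hh)) ↔ k < n + 1 ∧ k ≠ hh := by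
    intro n hh k
    rw [List.mem_filter, List.mem_range]
    constructor
    · rintro ⟨hk, hne⟩
      exact ⟨hk, fun hkh => by rw [hkh, Nat.beq_refl] at hne; exact Bool.noConfusion hne⟩
    · rintro ⟨hk, hne⟩
      refine ⟨hk, ?_⟩
      cases hq : Nat.beq k hh
      · rfl
      · exact absurd (Nat.eq_of_beq_eq_true hq) hne
  have hQLmem : ∀ v, v ∈ QL ↔ ∃ x ∈ B3 i, x.val = v := by
    intro v
    rw [hQL, hfilt, hB3i]
    constructor
    · rintro ⟨hv, hne⟩
      exact ⟨(v : ZMod p), mem_image.2 ⟨v, mem_erase.2 ⟨hne, mem_range.2 hv⟩, rfl⟩, ZMod.val_natCast_of_lt (by omega)⟩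
    · rintro ⟨x, hx, rfl⟩
      obtain ⟨k, hk, rfl⟩ := mem_image.1 hx
      rw [mem_erase, mem_range] at hk
      rw [ZMod.val_natCast_of_lt (by omega)]
      exact ⟨hk.2, hk.1⟩
  have hQLnd : QL.Nodup := List.nodup_range.filter _
  have hPLcast : ∀ k : ℕ, ((((d' * k) % p : ℕ)) : ZMod p) = (u * d) * (k : ZMod p) := fun k => by
    rw [cast_mod_self, Nat.cast_mul, hd', ZMod.natCast_zmod_val]
  have hPLmem : ∀ v, v ∈ PL ↔ ∃ x ∈ A3 i, x.val = v := by
    intro v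
    rw [hPL, List.mem_map, hA3i]
    constructor
    · rintro ⟨k, hk, rfl⟩
      rw [hfilt] at hk
      refine ⟨(u * d) * (k : ZMod p), mem_image.2 ⟨k, mem_erase.2 ⟨hk.2, mem_range.2 hk.1⟩, rfl⟩, ?_⟩
      rw [← hPLcast, ZMod.val_natCast, Nat.mod_eq_of_lt (Nat.mod_lt _ hp0)]
    · rintro ⟨x, hx, rfl⟩
      obtain ⟨k, hk, rfl⟩ := mem_image.1 hx
      rw [mem_erase, mem_range] at hk
      refine ⟨k, (hfilt _ _ _).2 ⟨hk.2, hk.1⟩, ?_⟩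
      rw [← hPLcast, ZMod.val_natCast, Nat.mod_eq_of_lt (Nat.mod_lt _ hp0)]
  have hPLnd : PL.Nodup := by
    rw [hPL]
    refine List.Nodup.map_on (fun k hk k' hk' hkk => ?_) (List.nodup_range.filter _)
    rw [hfilt] at hk hk'
    have hcast := congrArg (fun n : ℕ => (n : ZMod p)) hkk
    simp only [hPLcast] at hcast
    have := mul_left_cancel₀ hd'0 hcast
    have := congrArg ZMod.val this
    rwa [ZMod.val_natCast_of_lt (by omega), ZMod.val_natCast_of_lt (by omega)] at this
  -- the normal form kills the row at `(QL, PL, h₀)`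
  have hh₀mem : h₀ ∈ List.range' 1 z := List.mem_range'.2 ⟨h₀ - 1, by omega, by omega⟩
  rcases rowsC QL hQLq PL hPLp h₀ hh₀mem with row | row
  · have key := caseCDeadT_false_of_normal_form hS3' hA3ne hB3ne hC3ne i hb3 hc3 hL3 (by omega) hT3 hpart3 hZ3 PL QL hPLmem hPLnd
      hQLmem hQLnd ks hks hksi hszsA3 deadC
    rw [key] at row; exact Bool.noConfusion row
  · have key := caseCDeadTP_false_of_normal_form hS3' hA3ne hB3ne hC3ne i hb3 hc3 hL3 (by omega) hT3 hpart3 hZ3 PL QL hPLmem hPLnd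
      hQLmem hQLnd ks hks hksi hszsA3 deadC
    rw [key] at row; exact Bool.noConfusion row

end Summit.MatrixMultiplication.OmegaCensus.CubeNB.S2
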